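import Summits.Schanuel.Schanuel.Theorems.ZilberEacParamCurveEscapeLog
import Summits.Schanuel.Schanuel.Theorems.ZilberEacParamSurfaceEdge
import Summits.Schanuel.Schanuel.Theorems.ZilberEacGraphSurfaceUnbalanced
import HarnessLib

/-!
# Polynomially parametrised base curves, XVIII: non-split surfaces over a polynomial curve —
# escaping exponential points for EVERY `Q` with two `y₁`-degrees (balanced or unbalanced edge)

HONEST FRAMING.  Cell `pub-schanuel` (Zilber's Exponential-Algebraic Closedness, case ladder;
host summit Schanuel), seat 2, gen 19.  Port of gen 17's `exists_graphSurface_expPoints`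
(`ZilberEacGraphSurfaceUnbalanced`) to a polynomially parametrised base `t ↦ (g₀(t), g₁(t))`:
lower-left edge `(s, m_b)` of the `y`-support of `Q`, upper edge `(μ, κ)` of the edge points
`(m₂ - (m_b)₂, m₀)` (gen 17's `exists_upper_edge`, reused verbatim), a nonzero root of the edge
polynomial, and the directional engine with a logarithmic balance (file XVII) along the roots of
`g₁(t) + s g₀(t) - μ log t = 2πiN + log θ` on a root direction `ω` with
`Re(lc(g₀) ω^{deg g₀}) < 0`.  Result: zeros `t_k` of `Q(t; e^{g₀(t)}, e^{g₁(t)})` with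
`|Re g₀(t_k)|/log(2 + ‖g₀(t_k)‖) → ∞` for every `Q` with two monomials of different `y₁`-degree.
Density: `ZilberEacParamSurfaceAll`.  Instances of Mantova–Masser's OPEN question (PLMS 2024 §1
p. 5); NOT Schanuel's conjecture (neither used nor implied; EAC ⇏ SC); `EC(3,2)` stays OPEN.
-/

noncomputable section

open Filter Topology Metric Set Complex
open Literature.ModelTheory.Zilber

set_option linter.dupNamespace false

namespace Summit.Schanuel.Schanuel.Theorems

/-! ## Part A. The off-edge part in the logarithmic window (free variables) -/

section EdgeSum

variable {P : MvPolynomial (Fin 3) ℂ} {s : ℝ} {mb : Fin 3 →₀ ℕ}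

/-- **The off-edge part in the window `|Re(x₁ + s x₀) - μ log ‖t‖| ≤ B`** (`Re x₀ ≤ 0`,
`‖t‖ ≥ 1`): `‖E‖ ≤ (Σ_{m ∉ M} ‖c_m‖ e^{|m₂ - (m_b)₂| B}) (1 + ‖t‖)^{N + N'} e^{δ Re x₀}`. (new) -/
theorem norm_offEdgeSum₃_le_log₂ {δ B μ : ℝ} {N N' : ℕ}
    (hδ : ∀ m ∈ P.support, ¬ ((m 1 : ℝ) - s * m 2) = (mb 1 : ℝ) - s * mb 2 →
      δ ≤ ((m 1 : ℝ) - s * m 2) - ((mb 1 : ℝ) - s * mb 2))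
    (hN : ∀ m ∈ P.support, m 0 ≤ N)
    (hN' : ∀ m ∈ P.support, |(m 2 : ℝ) - mb 2| * |μ| ≤ N')
    {t x₀ x₁ : ℂ} (hz : x₀.re ≤ 0) (hz1 : 1 ≤ ‖t‖)
    (hB : |(x₁ + (s : ℂ) * x₀).re - μ * Real.log ‖t‖| ≤ B) :
    ‖∑ m ∈ P.support.filter
          (fun m : Fin 3 →₀ ℕ => ¬ ((m 1 : ℝ) - s * m 2) = (mb 1 : ℝ) - s * mb 2),
        P.coeff m * t ^ (m 0) *
          exp ((((m 1 : ℝ) - s * m 2 - ((mb 1 : ℝ) - s * mb 2) : ℝ) : ℂ) * x₀ +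
            (((m 2 : ℝ) - mb 2 : ℝ) : ℂ) * (x₁ + (s : ℂ) * x₀))‖ ≤
      (∑ m ∈ P.support.filter
          (fun m : Fin 3 →₀ ℕ => ¬ ((m 1 : ℝ) - s * m 2) = (mb 1 : ℝ) - s * mb 2),
          ‖P.coeff m‖ * Real.exp (|(m 2 : ℝ) - mb 2| * B)) * (1 + ‖t‖) ^ (N + N') *
        Real.exp (δ * x₀.re) := by
  classical
  set R₀z := x₁ + (s : ℂ) * x₀ with hR₀
  rw [Finset.sum_mul, Finset.sum_mul]
  refine (norm_sum_le _ _).trans (Finset.sum_le_sum fun m hm => ?_)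
  obtain ⟨hmA, hmw⟩ := Finset.mem_filter.1 hm
  rw [norm_mul, norm_mul, norm_pow, Complex.norm_exp, Complex.add_re, Complex.re_ofReal_mul,
    Complex.re_ofReal_mul]
  have hlog0 : 0 ≤ Real.log ‖t‖ := Real.log_nonneg hz1
  have h1 : ((m 1 : ℝ) - s * m 2 - ((mb 1 : ℝ) - s * mb 2)) * x₀.re ≤ δ * x₀.re :=
    mul_le_mul_of_nonpos_right (hδ m hmA hmw) hz
  -- `Δ Re R₀ = Δ (Re R₀ - μ log ‖z‖) + Δ μ log ‖z‖ ≤ |Δ| B + |Δ| |μ| log ‖z‖`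
  have h2 : ((m 2 : ℝ) - mb 2) * R₀z.re ≤
      |(m 2 : ℝ) - mb 2| * B + |(m 2 : ℝ) - mb 2| * |μ| * Real.log ‖t‖ := by
    have e1 : ((m 2 : ℝ) - mb 2) * R₀z.re =
        ((m 2 : ℝ) - mb 2) * (R₀z.re - μ * Real.log ‖t‖) +
          ((m 2 : ℝ) - mb 2) * μ * Real.log ‖t‖ := by ring
    rw [e1]
    refine add_le_add ?_ ?_
    · refine (le_abs_self _).trans ?_
      rw [abs_mul]
      exact mul_le_mul_of_nonneg_left hB (abs_nonneg _)
    · have : ((m 2 : ℝ) - mb 2) * μ ≤ |(m 2 : ℝ) - mb 2| * |μ| := by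
        rw [← abs_mul]; exact le_abs_self _
      exact mul_le_mul_of_nonneg_right this hlog0
  have hzN : ‖t‖ ^ (m 0) ≤ (1 + ‖t‖) ^ N :=
    (pow_le_pow_left₀ (norm_nonneg _) (by linarith [norm_nonneg t]) _).trans
      (pow_le_pow_right₀ (by linarith [norm_nonneg t]) (hN m hmA))
  have hzN' : Real.exp (|(m 2 : ℝ) - mb 2| * |μ| * Real.log ‖t‖) ≤ (1 + ‖t‖) ^ N' :=
    exp_mul_log_le_pow (hN' m hmA) hz1 (by linarith)
  have hexp : Real.exp (((m 1 : ℝ) - s * m 2 - ((mb 1 : ℝ) - s * mb 2)) * x₀.re +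
      ((m 2 : ℝ) - mb 2) * R₀z.re) ≤
      Real.exp (|(m 2 : ℝ) - mb 2| * B) * (1 + ‖t‖) ^ N' * Real.exp (δ * x₀.re) := by
    calc Real.exp (((m 1 : ℝ) - s * m 2 - ((mb 1 : ℝ) - s * mb 2)) * x₀.re +
          ((m 2 : ℝ) - mb 2) * R₀z.re)
        ≤ Real.exp (|(m 2 : ℝ) - mb 2| * B + |(m 2 : ℝ) - mb 2| * |μ| * Real.log ‖t‖ +
            δ * x₀.re) := Real.exp_le_exp.2 (by linarith)
      _ = Real.exp (|(m 2 : ℝ) - mb 2| * B) *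
            Real.exp (|(m 2 : ℝ) - mb 2| * |μ| * Real.log ‖t‖) * Real.exp (δ * x₀.re) := by
          rw [Real.exp_add, Real.exp_add]
      _ ≤ Real.exp (|(m 2 : ℝ) - mb 2| * B) * (1 + ‖t‖) ^ N' * Real.exp (δ * x₀.re) := by
          gcongr
  calc ‖P.coeff m‖ * ‖t‖ ^ (m 0) * Real.exp (((m 1 : ℝ) - s * m 2 - ((mb 1 : ℝ) - s * mb 2)) *
        x₀.re + ((m 2 : ℝ) - mb 2) * R₀z.re)
      ≤ ‖P.coeff m‖ * (1 + ‖t‖) ^ N *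
          (Real.exp (|(m 2 : ℝ) - mb 2| * B) * (1 + ‖t‖) ^ N' * Real.exp (δ * x₀.re)) :=
        mul_le_mul (mul_le_mul_of_nonneg_left hzN (norm_nonneg _)) hexp (Real.exp_nonneg _)
          (by positivity)
    _ = ‖P.coeff m‖ * Real.exp (|(m 2 : ℝ) - mb 2| * B) * (1 + ‖t‖) ^ (N + N') *
          Real.exp (δ * x₀.re) := by
        rw [pow_add]; ring

end EdgeSum

/-! ## Part B. Escaping exponential points for every `Q` with two `y₁`-degrees -/

/-- **Escaping zeros of `Q(t; e^{g₀(t)}, e^{g₁(t)})`, no balance hypothesis.**  `deg g₀ ≥ 1`;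
`Q` with two monomials of different `y₁`-degree; for every real `s`, `R_s = g₁ + s g₀` of degree
`≥ 2` with a root direction `ω` such that `Re(lc(g₀) ω^{deg g₀}) < 0`.  Then there are `t_k` with
`Q(t_k; e^{g₀(t_k)}, e^{g₁(t_k)}) = 0` and `|Re g₀(t_k)|/log(2 + ‖g₀(t_k)‖) → ∞`. (new) -/
theorem exists_paramSurface_expPoints (g₀ g₁ : Polynomial ℂ) (hg₀ : 1 ≤ g₀.natDegree)
    (P : MvPolynomial (Fin 3) ℂ) (h2 : ∃ m ∈ P.support, ∃ m' ∈ P.support, m 2 ≠ m' 2)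
    (hdir : ∀ s : ℝ, 2 ≤ (g₁ + Polynomial.C (s : ℂ) * g₀).natDegree ∧
      ∃ (ω : ℂ) (σ : ℤ), (σ = 1 ∨ σ = -1) ∧
        (g₁ + Polynomial.C (s : ℂ) * g₀).leadingCoeff *
            ω ^ (g₁ + Polynomial.C (s : ℂ) * g₀).natDegree = 2 * Real.pi * I * σ ∧
        (g₀.leadingCoeff * ω ^ g₀.natDegree).re < 0) :
    ∃ t : ℕ → ℂ, (∀ k, MvPolynomial.eval ![t k, exp (g₀.eval (t k)), exp (g₁.eval (t k))] P = 0) ∧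
      Tendsto (fun k => |(g₀.eval (t k)).re| / Real.log (2 + ‖g₀.eval (t k)‖)) atTop atTop := by
  classical
  obtain ⟨s, mb, hmb, hE1, hE2, ms, hmsA, hms2, hmsw⟩ := exists_lowerLeft_edge₃ P.support h2
  obtain ⟨hdR, ω, σ, hσ, hω, hre⟩ := hdir s
  set R₀ : Polynomial ℂ := g₁ + Polynomial.C (s : ℂ) * g₀ with hR₀
  have hReval : ∀ t : ℂ, R₀.eval t = g₁.eval t + (s : ℂ) * g₀.eval t := by
    intro t; simp [hR₀, Polynomial.eval_add, Polynomial.eval_mul]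
  set M := P.support.filter
    (fun m : Fin 3 →₀ ℕ => ((m 1 : ℝ) - s * m 2) = (mb 1 : ℝ) - s * mb 2) with hM
  set Nf := P.support.filter
    (fun m : Fin 3 →₀ ℕ => ¬ ((m 1 : ℝ) - s * m 2) = (mb 1 : ℝ) - s * mb 2) with hNf
  have hmbM : mb ∈ M := Finset.mem_filter.2 ⟨hmb, rfl⟩
  have hmsM : ms ∈ M := Finset.mem_filter.2 ⟨hmsA, hmsw⟩
  have hMle : ∀ m ∈ M, mb 2 ≤ m 2 := fun m hm =>
    hE2 m (Finset.mem_filter.1 hm).1 (Finset.mem_filter.1 hm).2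
  -- the coefficient polynomials and exponents of the edge sum
  set q : (Fin 3 →₀ ℕ) → Polynomial ℂ := fun m =>
    Polynomial.C (P.coeff m) * Polynomial.X ^ (m 0) with hq_def
  set e : (Fin 3 →₀ ℕ) → ℕ := fun m => m 2 - mb 2 with he_def
  have hq_deg : ∀ m ∈ M, (q m).natDegree = m 0 := fun m hm =>
    Polynomial.natDegree_C_mul_X_pow _ _
      (MvPolynomial.mem_support_iff.1 (Finset.mem_filter.1 hm).1)
  have hq_lc : ∀ m, (q m).leadingCoeff = P.coeff m := fun m =>
    Polynomial.leadingCoeff_C_mul_X_pow _ _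
  -- the upper edge `(μ, κ)` of the edge points `(m₂ - (m_b)₂, m₀)`
  obtain ⟨μ, κ, hκ, ma, hma, mc, hmc, hjne, hja, hjc⟩ := exists_upper_edge M e (fun m => m 0)
    ⟨mb, hmbM, ms, hmsM, by
      have hlt : mb 2 < ms 2 := lt_of_le_of_ne (hMle ms hmsM) (Ne.symm hms2)
      simp only [he_def]; omega⟩
  have hκ' : ∀ m ∈ M, ((q m).natDegree : ℝ) + μ * e m ≤ κ := fun m hm => by
    rw [hq_deg m hm]; exact hκ m hm
  -- the top set and its polynomial
  set Jt := M.filter (fun m => ((q m).natDegree : ℝ) + μ * e m = κ) with hJt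
  set Qμ : Polynomial ℂ := ∑ m ∈ Jt, Polynomial.C (q m).leadingCoeff * Polynomial.X ^ (e m)
    with hQμ
  have hmem_top : ∀ {m}, m ∈ M → ((m 0 : ℝ) + μ * e m = κ) → m ∈ Jt := fun {m} hm h =>
    Finset.mem_filter.2 ⟨hm, by rw [hq_deg m hm]; exact h⟩
  have hmaT : ma ∈ Jt := hmem_top hma hja
  have hmcT : mc ∈ Jt := hmem_top hmc hjc
  -- distinct top exponents have distinct `e`
  have hinj : ∀ m ∈ Jt, ∀ m' ∈ Jt, e m = e m' → m = m' := by
    intro m hm m' hm' hee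
    obtain ⟨hmM, hmt⟩ := Finset.mem_filter.1 hm
    obtain ⟨hm'M, hm't⟩ := Finset.mem_filter.1 hm'
    have h2eq : m 2 = m' 2 := by
      have := hMle m hmM; have := hMle m' hm'M
      simp only [he_def] at hee; omega
    have h0eq : m 0 = m' 0 := by
      rw [hq_deg m hmM] at hmt; rw [hq_deg m' hm'M] at hm't
      rw [hee] at hmt
      have : (m 0 : ℝ) = m' 0 := by linarith
      exact_mod_cast this
    exact gse_eq_of_weight_eq ((Finset.mem_filter.1 hmM).2.trans (Finset.mem_filter.1 hm'M).2.symm)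
      h2eq h0eq
  -- the coefficient of `Q_μ` at `e m₁` (`m₁` top) is `c_{m₁} ≠ 0`
  have hcoeff : ∀ m₁ ∈ Jt, Qμ.coeff (e m₁) = P.coeff m₁ := by
    intro m₁ hm₁
    rw [hQμ, Polynomial.finsetSum_coeff, Finset.sum_eq_single m₁]
    · rw [Polynomial.coeff_C_mul, Polynomial.coeff_X_pow, if_pos rfl, mul_one, hq_lc]
    · intro m hm hne
      rw [Polynomial.coeff_C_mul, Polynomial.coeff_X_pow, if_neg, mul_zero]
      exact fun h => hne (hinj m hm m₁ hm₁ h.symm)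
    · intro h; exact (h hm₁).elim
  have hca : Qμ.coeff (e ma) ≠ 0 := by
    rw [hcoeff ma hmaT]; exact MvPolynomial.mem_support_iff.1 (Finset.mem_filter.1 hma).1
  have hcc : Qμ.coeff (e mc) ≠ 0 := by
    rw [hcoeff mc hmcT]; exact MvPolynomial.mem_support_iff.1 (Finset.mem_filter.1 hmc).1
  -- a nonzero root of `Q_μ`, and `Q_μ ≠ 0`
  obtain ⟨θ, hθ0, hθ⟩ : ∃ θ : ℂ, θ ≠ 0 ∧ Qμ.eval θ = 0 := by
    rcases lt_or_gt_of_ne hjne with hlt | hgt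
    · exact exists_root_ne_zero_of_coeff_ne_zero (e mc) Qμ (e ma) hlt hca hcc
    · exact exists_root_ne_zero_of_coeff_ne_zero (e ma) Qμ (e mc) hgt hcc hca
  have hQ : Qμ ≠ 0 := fun h => hca (by rw [h, Polynomial.coeff_zero])
  -- the weight gap `δ`, the degree bounds `N`, `N'`
  obtain ⟨δ, hδpos, hδ⟩ : ∃ δ : ℝ, 0 < δ ∧ ∀ m ∈ P.support,
      ¬ ((m 1 : ℝ) - s * m 2) = (mb 1 : ℝ) - s * mb 2 →
        δ ≤ ((m 1 : ℝ) - s * m 2) - ((mb 1 : ℝ) - s * mb 2) := by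
    by_cases hNe : Nf.Nonempty
    · obtain ⟨mm, hmm, hmmmin⟩ := Nf.exists_min_image
        (fun m => ((m 1 : ℝ) - s * m 2) - ((mb 1 : ℝ) - s * mb 2)) hNe
      obtain ⟨hmmA, hmmw⟩ := Finset.mem_filter.1 hmm
      refine ⟨((mm 1 : ℝ) - s * mm 2) - ((mb 1 : ℝ) - s * mb 2), ?_, fun m hm hmw =>
        hmmmin m (Finset.mem_filter.2 ⟨hm, hmw⟩)⟩
      have := hE1 mm hmmA
      rcases this.lt_or_eq with h | h
      · linarith
      · exact absurd h.symm hmmw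
    · refine ⟨1, zero_lt_one, fun m hm hmw => ?_⟩
      exact absurd ⟨m, Finset.mem_filter.2 ⟨hm, hmw⟩⟩ hNe
  set N : ℕ := P.support.sup (fun m => m 0) with hNdef
  have hN : ∀ m ∈ P.support, m 0 ≤ N := fun m hm => Finset.le_sup (f := fun m => m 0) hm
  set N₂ : ℕ := P.support.sup (fun m => m 2) with hN₂def
  have hN₂ : ∀ m ∈ P.support, m 2 ≤ N₂ := fun m hm => Finset.le_sup (f := fun m => m 2) hm
  set N' : ℕ := ⌈(N₂ : ℝ) * |μ|⌉₊ with hN'def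
  have hN' : ∀ m ∈ P.support, |(m 2 : ℝ) - mb 2| * |μ| ≤ N' := by
    intro m hm
    have h1 : |(m 2 : ℝ) - mb 2| ≤ N₂ := by
      rw [abs_le]
      have := hN₂ m hm; have := hN₂ mb hmb
      constructor
      · have : (mb 2 : ℝ) ≤ N₂ := by exact_mod_cast hN₂ mb hmb
        linarith [(Nat.cast_nonneg (m 2) : (0 : ℝ) ≤ m 2)]
      · have : (m 2 : ℝ) ≤ N₂ := by exact_mod_cast hN₂ m hm
        linarith [(Nat.cast_nonneg (mb 2) : (0 : ℝ) ≤ mb 2)]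
    exact (mul_le_mul_of_nonneg_right h1 (abs_nonneg μ)).trans (Nat.le_ceil _)
  -- the off-edge part
  set E : ℂ → ℂ := fun t => ∑ m ∈ Nf, P.coeff m * t ^ (m 0) *
    exp ((((m 1 : ℝ) - s * m 2 - ((mb 1 : ℝ) - s * mb 2) : ℝ) : ℂ) * g₀.eval t +
      (((m 2 : ℝ) - mb 2 : ℝ) : ℂ) * R₀.eval t) with hEdef
  have hEdiff : Differentiable ℂ E := by
    refine Differentiable.fun_sum fun m _ => ?_
    refine ((differentiable_const _).mul (differentiable_id.pow _)).mul ?_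
    refine (((differentiable_const _).mul (Polynomial.differentiable _)).add
      ((differentiable_const _).mul (Polynomial.differentiable _))).cexp
  have hEb : ∀ B : ℝ, ∃ C : ℝ, 0 ≤ C ∧ ∃ N'' : ℕ, ∀ t : ℂ, (g₀.eval t).re ≤ 0 → 1 ≤ ‖t‖ →
      |(R₀.eval t).re - μ * Real.log ‖t‖| ≤ B →
        ‖E t‖ ≤ C * (1 + ‖t‖) ^ N'' * Real.exp (δ * (g₀.eval t).re) := by
    intro B
    refine ⟨∑ m ∈ Nf, ‖P.coeff m‖ * Real.exp (|(m 2 : ℝ) - mb 2| * B),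
      Finset.sum_nonneg fun m _ => by positivity, N + N', fun t ht ht1 htB => ?_⟩
    have htB' : |(g₁.eval t + (s : ℂ) * g₀.eval t).re - μ * Real.log ‖t‖| ≤ B := by
      rwa [hReval] at htB
    have h := norm_offEdgeSum₃_le_log₂ (P := P) hδ hN hN' (t := t) ht ht1 htB'
    simp only [hEdef, hReval]
    exact h
  -- engine v3, directional
  obtain ⟨t, L, A, hL, ht⟩ := exists_escape_zeros_log_dir R₀ g₀ hdR hg₀ M q e μ κ hκ' hθ0 hθ hQ
    ω σ hσ hω hre E hEdiff hδpos hEb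
  refine ⟨t, fun k => ?_, tendsto_abs_re_div_log_of_escape hL (fun k => (ht k).2.1)
    (fun k => (ht k).2.2)⟩
  rw [eval₃_exp_exp_eq_mul_edgeSum hE2 (t k) (g₀.eval (t k)) (g₁.eval (t k))]
  have h := (ht k).1
  rw [hEdef] at h
  simp only [hReval] at h
  rw [h, mul_zero]

end Summit.Schanuel.Schanuel.Theorems
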